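import Mathlib
import HarnessLib
import Summits.NavierStokesRegularity.NavierStokesRegularity.Theorems.PoloidalWindowDoorPoloidalWindowRigidityPoloidalExtremal
import Summits.NavierStokesRegularity.NavierStokesRegularity.Theorems.PoloidalWindowDoorPoloidalWindowRigidityWindow
import Summits.NavierStokesRegularity.NavierStokesRegularity.Theorems.PoloidalWindowDoorPoloidalWindowRigidityFlat

/-!
# Door S11 `LocalTubeDoorHelicity`, profile crux K2⁗ `FrobeniusProfileRigidity` — an EXTREMAL ELEMENT of ANY
# symmetry-invariant, limit-closed sub-class of the KNSS Type-I ancient mild class; instance: the Frobenius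
# (helicity-free) sub-class

Cell ns-regularity-ideate, seat p6 (route-directed support for the door route `route-helicity` staged by nsreg-p1; lands
`--supports` the K2⁗ item; no claim on the crux).  The K2 lead's normal form (H1) for the POLOIDAL sub-class
(`…PoloidalWindowRigidityPoloidalExtremal.exists_poloidal_extremal`, ns-poloidal-K2-p1: KNSS 2009 §6 extremal-constant
argument run INSIDE a sub-class closed under translations, parabolic rescalings and the `C¹_loc` KNSS limits) is stated
here ONCE for an ABSTRACT sub-class predicate `P` and then instantiated for the helicity-free class of door S11:

* `exists_extremal_of_subclass` — **generic**: if `P` is preserved by spatial translations and by the parabolic rescalings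
  `nsRescale c`, `c > 0`, and is closed under pointwise convergence of fields AND gradients on the open slab, and some
  `P`-element of some `𝔓(C)` is nontrivial, then there are `C⋆ > 0` and a `P`-element `W ∈ 𝔓(C⋆)` with
  `‖W(−1,0)‖ = C⋆`, `√(−t)‖W(t,x)‖ ≤ ‖W(−1,0)‖` on the slab, and `C⋆ ≤ C'` whenever `𝔓(C')` contains a nontrivial
  `P`-element (proof = the lead's, verbatim with the predicate abstracted: gap `exists_typeIAncientMild_eq_zero_of_small`,
  minimising sequence renormalised to the hot spot, compactness `exists_tendsto_of_isTypeIAncientMild_seq`);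
* `helicityFree_translate`, `helicityFree_nsRescale`, `helicityFree_of_tendsto` — the Frobenius predicate
  `∀ s < 0, ∀ y, ⟪v s y, curl (v s) y⟫ = 0` has the three properties;
* `exists_frobenius_extremal` — **the normal form for a K2⁗ residue prover**: if K2⁗ fails through a NONTRIVIAL
  helicity-free profile, then WLOG the profile is EXTREMAL in the Frobenius sub-class and attains its sharp Type-I constant
  at the hot spot `(−1,0)`;
* `frobeniusProfileRigidity_of_no_extremal` — hence **K2⁗ (profile form, verbatim the `hprofile` binder of the tree
  theorem `localTubeDoorHelicity_of_profileRigidity`) ⇐ «no extremal helicity-free element exists»** (a nontrivial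
  element is what backward singularity provides: a profile vanishing identically is not backward-singular, tree
  `not_backwardSingular_of_zero`).

SUPPORT EDGE (route-NavierStokesRegularity-LocalHelicityTubeDoor born; director-ns g6 #1 (5)): this file is re-pointed
`--supports stmt-NavierStokesRegularity-19975 --as helper` (nsreg-p6 g6 p477139: extremal normal form for the helicity-free sub-class); it was parked on the
CLOSED fallback anchor stmt-NavierStokesRegularity-20018 while the route was unborn.  Declarations unchanged.

WHAT THIS IS NOT: not a claim about Navier–Stokes regularity and not K2⁗ — a normal form (compactness + symmetry, no
new mechanism) for a door route's open profile crux (bears_on LADDER-NS N0, door S11).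
-/

noncomputable section

-- the summit and its single sub-problem share the name (CONVENTIONS §1), as in every Theorems file
set_option linter.dupNamespace false

namespace Summit.NavierStokesRegularity.NavierStokesRegularity.Theorems.LocalHelicityTubeDoorFrobeniusProfileRigidityExtremal

open MeasureTheory Set Function Filter Topology
open scoped RealInnerProductSpace InnerProductSpace
open Literature.Analysis Literature.Analysis.FluidPDE
open Summit.NavierStokesRegularity.NavierStokesRegularity.Theorems
open Summit.NavierStokesRegularity.NavierStokesRegularity.Theorems.PoloidalWindowDoorPoloidalWindowRigidityPoloidalExtremal
open Summit.NavierStokesRegularity.NavierStokesRegularity.Theorems.PoloidalWindowDoorPoloidalWindowRigidityWindow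
open Summit.NavierStokesRegularity.NavierStokesRegularity.Theorems.PoloidalWindowDoorPoloidalWindowRigidityFlat

/-! ### The generic extremal element -/

/-- **An extremal element of an invariant, limit-closed sub-class exists.**  Let `P` be a property of profiles
`ℝ → ℝ³ → ℝ³` preserved by spatial translations and by the parabolic rescalings `nsRescale c` (`c > 0`), and closed
under pointwise convergence of fields and gradients on the open slab.  If some `P`-element of some KNSS Type-I ancient
mild class `𝔓(C)` is nontrivial, then the least Type-I constant `C⋆` carried by a nontrivial `P`-element is positive and
ATTAINED by a `P`-element `W ∈ 𝔓(C⋆)` at the hot spot: `‖W(−1,0)‖ = C⋆` and `√(−t)‖W(t,x)‖ ≤ ‖W(−1,0)‖` on the slab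
(KNSS 2009 §6; the K2 lead's `exists_poloidal_extremal` with the sub-class abstracted). -/
theorem exists_extremal_of_subclass
    (P : (ℝ → EuclideanSpace ℝ (Fin 3) → EuclideanSpace ℝ (Fin 3)) → Prop)
    (hPtr : ∀ (u : ℝ → EuclideanSpace ℝ (Fin 3) → EuclideanSpace ℝ (Fin 3)) (x₀ : EuclideanSpace ℝ (Fin 3)),
      P u → P (fun t x => u t (x₀ + x)))
    (hPsc : ∀ (u : ℝ → EuclideanSpace ℝ (Fin 3) → EuclideanSpace ℝ (Fin 3)) (c : ℝ), 0 < c → P u → P (nsRescale c u))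
    (hPlim : ∀ (V : ℕ → ℝ → EuclideanSpace ℝ (Fin 3) → EuclideanSpace ℝ (Fin 3))
      (W : ℝ → EuclideanSpace ℝ (Fin 3) → EuclideanSpace ℝ (Fin 3)), (∀ k, P (V k)) →
      (∀ t < 0, ∀ x, Tendsto (fun k => V k t x) atTop (𝓝 (W t x))) →
      (∀ t < 0, ∀ x, Tendsto (fun k => fderiv ℝ (V k t) x) atTop (𝓝 (fderiv ℝ (W t) x))) → P W)
    (hex : ∃ (C : ℝ) (u : ℝ → EuclideanSpace ℝ (Fin 3) → EuclideanSpace ℝ (Fin 3)), IsTypeIAncientMild C u ∧ P u ∧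
      ∃ t < 0, ∃ x, u t x ≠ 0) :
    ∃ (Cs : ℝ) (W : ℝ → EuclideanSpace ℝ (Fin 3) → EuclideanSpace ℝ (Fin 3)), 0 < Cs ∧ IsTypeIAncientMild Cs W ∧ P W ∧
      ‖W (-1) 0‖ = Cs ∧
      (∀ t < 0, ∀ x, Real.sqrt (-t) * ‖W t x‖ ≤ ‖W (-1) 0‖) ∧
      ∀ (C' : ℝ) (u' : ℝ → EuclideanSpace ℝ (Fin 3) → EuclideanSpace ℝ (Fin 3)), IsTypeIAncientMild C' u' → P u' →
        (∃ t < 0, ∃ x, u' t x ≠ 0) → Cs ≤ C' := by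
  obtain ⟨C₀, u₀, hu₀, hP₀, hne₀⟩ := hex
  -- ## the set of admissible constants of nontrivial `P`-elements and its infimum
  set S : Set ℝ := {C' | ∃ u' : ℝ → EuclideanSpace ℝ (Fin 3) → EuclideanSpace ℝ (Fin 3),
    IsTypeIAncientMild C' u' ∧ P u' ∧ ∃ t < 0, ∃ x, u' t x ≠ 0} with hS
  have hmem : ∀ {C' : ℝ} {u' : ℝ → EuclideanSpace ℝ (Fin 3) → EuclideanSpace ℝ (Fin 3)},
      IsTypeIAncientMild C' u' → P u' → (∃ t < 0, ∃ x, u' t x ≠ 0) → C' ∈ S :=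
    fun hu' hp hne' => ⟨_, hu', hp, hne'⟩
  have hSne : S.Nonempty := ⟨C₀, hmem hu₀ hP₀ hne₀⟩
  obtain ⟨ε, hε, hsmall⟩ := exists_typeIAncientMild_eq_zero_of_small
  have hSε : ∀ C' ∈ S, ε < C' := by
    rintro C' ⟨u', hu', -, t, ht, x, hx⟩
    by_contra hle
    push Not at hle
    exact hx (hsmall C' u' hu' hle t ht x)
  have hSbdd : BddBelow S := ⟨ε, fun C' hC' => (hSε C' hC').le⟩
  set Cs : ℝ := sInf S with hCs
  have hεCs : ε ≤ Cs := le_csInf hSne fun C' hC' => (hSε C' hC').le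
  have hCs0 : 0 < Cs := hε.trans_le hεCs
  have hCsle : ∀ C' ∈ S, Cs ≤ C' := fun C' hC' => csInf_le hSbdd hC'
  -- ## a minimising sequence of nontrivial `P`-elements
  have hδpos : ∀ k : ℕ, (0 : ℝ) < 1 / ((k : ℝ) + 1) := fun k => by positivity
  have hseq : ∀ k : ℕ, ∃ C' ∈ S, C' < Cs + 1 / ((k : ℝ) + 1) := fun k =>
    exists_lt_of_csInf_lt hSne (by linarith [hδpos k])
  choose Ck hCkS hCklt using hseq
  have hCkge : ∀ k, Cs ≤ Ck k := fun k => hCsle _ (hCkS k)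
  have hCkS' : ∀ k, ∃ u' : ℝ → EuclideanSpace ℝ (Fin 3) → EuclideanSpace ℝ (Fin 3),
      IsTypeIAncientMild (Ck k) u' ∧ P u' ∧ ∃ t < 0, ∃ x, u' t x ≠ 0 := fun k => hCkS k
  choose uk huk hukP hukne using hCkS'
  -- near-maximal points: otherwise `u_k ∈ 𝔓(C⋆ − 1/(k+1))`, against the minimality of `C⋆`
  have hpts : ∀ k : ℕ, ∃ t < 0, ∃ x : EuclideanSpace ℝ (Fin 3),
      Cs - 1 / ((k : ℝ) + 1) < Real.sqrt (-t) * ‖uk k t x‖ := by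
    intro k
    by_contra h
    push Not at h
    have hmemk : Cs - 1 / ((k : ℝ) + 1) ∈ S := by
      refine hmem ⟨(huk k).1, (huk k).2.1, (huk k).2.2.1, fun t ht x => ?_⟩ (hukP k) (hukne k)
      rw [le_div_iff₀ (Real.sqrt_pos.2 (neg_pos.2 ht)), mul_comm]
      exact h t ht x
    linarith [hCsle _ hmemk, hδpos k]
  choose tk htk xk hxk using hpts
  -- ## renormalisation to the hot spot `(−1, 0)`
  set vk : ℕ → ℝ → EuclideanSpace ℝ (Fin 3) → EuclideanSpace ℝ (Fin 3) := fun k =>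
    nsRescale (Real.sqrt (-tk k)) (fun t x => uk k t (xk k + x)) with hvk_def
  have hck : ∀ k, 0 < Real.sqrt (-tk k) := fun k => Real.sqrt_pos.2 (neg_pos.2 (htk k))
  have hvk : ∀ k, IsTypeIAncientMild (Ck k) (vk k) := fun k =>
    isTypeIAncientMild_nsRescale (isTypeIAncientMild_translate (huk k) (xk k)) (hck k)
  have hvkP : ∀ k, P (vk k) := fun k => hPsc _ _ (hck k) (hPtr _ (xk k) (hukP k))
  -- a common constant: `𝔓(C_k) ⊆ 𝔓(C⋆ + 1)`
  have hCk1 : ∀ k : ℕ, Ck k ≤ Cs + 1 := fun k => by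
    have h1 : 1 / ((k : ℝ) + 1) ≤ 1 := by
      rw [div_le_one (by positivity)]; linarith [(k.cast_nonneg : (0 : ℝ) ≤ k)]
    linarith [hCklt k]
  have hvk' : ∀ k, IsTypeIAncientMild (Cs + 1) (vk k) := fun k =>
    ⟨(hvk k).1, (hvk k).2.1, (hvk k).2.2.1, fun t ht x =>
      ((hvk k).norm_le ht x).trans (div_le_div_of_nonneg_right (hCk1 k) (Real.sqrt_nonneg _))⟩
  have hval : ∀ k, ‖vk k (-1) 0‖ = Real.sqrt (-tk k) * ‖uk k (tk k) (xk k)‖ := fun k => by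
    simp only [hvk_def]
    rw [nsRescale_apply, smul_zero, add_zero, mul_neg_one, Real.sq_sqrt (neg_nonneg.2 (htk k).le),
      neg_neg, norm_smul, Real.norm_of_nonneg (Real.sqrt_nonneg _)]
  have hlow : ∀ k : ℕ, Cs - 1 / ((k : ℝ) + 1) < ‖vk k (-1) 0‖ := fun k => by
    rw [hval k]; exact hxk k
  have hup : ∀ k, ‖vk k (-1) 0‖ ≤ Ck k := fun k => by
    have h := (hvk k).norm_le (t := -1) (by norm_num) 0
    rwa [neg_neg, Real.sqrt_one, div_one] at h
  -- ## compactness of the class `𝔓(C⋆ + 1)`, fields AND gradients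
  obtain ⟨φ, hφ, W, hW, hpt, hDpt, -, -⟩ := exists_tendsto_of_isTypeIAncientMild_seq (Cs + 1) hvk'
  have hφt : Tendsto φ atTop atTop := hφ.tendsto_atTop
  have hδ : Tendsto (fun j => 1 / (((φ j : ℕ) : ℝ) + 1)) atTop (𝓝 0) :=
    (tendsto_one_div_add_atTop_nhds_zero_nat (𝕜 := ℝ)).comp hφt
  have hCφ : Tendsto (fun j => Ck (φ j)) atTop (𝓝 Cs) := by
    have hupper : Tendsto (fun j => Cs + 1 / (((φ j : ℕ) : ℝ) + 1)) atTop (𝓝 Cs) := by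
      simpa using tendsto_const_nhds.add hδ
    exact tendsto_of_tendsto_of_tendsto_of_le_of_le tendsto_const_nhds hupper
      (fun j => hCkge (φ j)) (fun j => (hCklt (φ j)).le)
  -- ## the limit: Type-I bound with the sharp constant, in the sub-class, and the attained value
  have hWI : HasTypeITimeDecay Cs W := fun t ht x =>
    le_of_tendsto_of_tendsto' (hpt t ht x).norm (hCφ.div_const (Real.sqrt (-t)))
      fun j => (hvk (φ j)).norm_le ht x
  have hWs : IsTypeIAncientMild Cs W := ⟨hW.1, hW.2.1, hW.2.2.1, hWI⟩
  have hWP : P W := hPlim (fun j => vk (φ j)) W (fun j => hvkP (φ j)) hpt hDpt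
  have hnorm : ‖W (-1) 0‖ = Cs := by
    have hlower : Tendsto (fun j => Cs - 1 / (((φ j : ℕ) : ℝ) + 1)) atTop (𝓝 Cs) := by
      simpa using tendsto_const_nhds.sub hδ
    have hsq : Tendsto (fun j => ‖vk (φ j) (-1) 0‖) atTop (𝓝 Cs) :=
      tendsto_of_tendsto_of_tendsto_of_le_of_le hlower hCφ (fun j => (hlow (φ j)).le)
        (fun j => hup (φ j))
    exact tendsto_nhds_unique ((hpt (-1) (by norm_num) 0).norm) hsq
  have hhot : ∀ t < 0, ∀ x, Real.sqrt (-t) * ‖W t x‖ ≤ ‖W (-1) 0‖ := fun t ht x => by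
    rw [hnorm, ← le_div_iff₀' (Real.sqrt_pos.2 (neg_pos.2 ht))]
    exact hWs.norm_le ht x
  -- ## conclusion
  exact ⟨Cs, W, hCs0, hWs, hWP, hnorm, hhot, fun C' u' hu' hp hne' => hCsle C' (hmem hu' hp hne')⟩

/-! ### The Frobenius (helicity-free) predicate has the three properties -/

/-- Helicity-freeness is preserved by translation. -/
theorem helicityFree_translate {u : ℝ → EuclideanSpace ℝ (Fin 3) → EuclideanSpace ℝ (Fin 3)}
    (hhel : ∀ s < 0, ∀ y, ⟪u s y, curl (u s) y⟫_ℝ = 0) (x₀ : EuclideanSpace ℝ (Fin 3)) :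
    ∀ s < 0, ∀ y, ⟪(fun t x => u t (x₀ + x)) s y, curl ((fun t x => u t (x₀ + x)) s) y⟫_ℝ = 0 := by
  intro s hs y
  rw [show (fun t x => u t (x₀ + x)) s = fun x => u s (x₀ + x) from rfl, curl_translate]
  exact hhel s hs _

/-- Helicity-freeness is preserved by parabolic rescaling. -/
theorem helicityFree_nsRescale {u : ℝ → EuclideanSpace ℝ (Fin 3) → EuclideanSpace ℝ (Fin 3)}
    (hhel : ∀ s < 0, ∀ y, ⟪u s y, curl (u s) y⟫_ℝ = 0) {c : ℝ} (hc : 0 < c) :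
    ∀ s < 0, ∀ y, ⟪nsRescale c u s y, curl (nsRescale c u s) y⟫_ℝ = 0 := by
  intro s hs y
  rw [curl_nsRescale_slice, nsRescale_apply, inner_smul_left, inner_smul_right,
    hhel _ (mul_neg_of_pos_of_neg (pow_pos hc 2) hs), mul_zero, mul_zero]

/-- Helicity-freeness passes to pointwise limits of fields and gradients. -/
theorem helicityFree_of_tendsto {V : ℕ → ℝ → EuclideanSpace ℝ (Fin 3) → EuclideanSpace ℝ (Fin 3)}
    {W : ℝ → EuclideanSpace ℝ (Fin 3) → EuclideanSpace ℝ (Fin 3)}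
    (hV : ∀ k, ∀ s < 0, ∀ y, ⟪V k s y, curl (V k s) y⟫_ℝ = 0)
    (hpt : ∀ t < 0, ∀ x, Tendsto (fun k => V k t x) atTop (𝓝 (W t x)))
    (hDpt : ∀ t < 0, ∀ x, Tendsto (fun k => fderiv ℝ (V k t) x) atTop (𝓝 (fderiv ℝ (W t) x))) :
    ∀ s < 0, ∀ y, ⟪W s y, curl (W s) y⟫_ℝ = 0 := by
  intro s hs y
  have ht : Tendsto (fun k => ⟪V k s y, curl (V k s) y⟫_ℝ) atTop (𝓝 ⟪W s y, curl (W s) y⟫_ℝ) :=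
    (hpt s hs y).inner (tendsto_curl_of_tendsto_fderiv (hDpt s hs y))
  have h0 : Tendsto (fun k => ⟪V k s y, curl (V k s) y⟫_ℝ) atTop (𝓝 0) := by
    simp only [hV _ s hs]; exact tendsto_const_nhds
  exact tendsto_nhds_unique ht h0

/-! ### The extremal helicity-free profile -/

/-- **An extremal Frobenius profile exists** (instance of `exists_extremal_of_subclass`): if some helicity-free element
of some KNSS Type-I class `𝔓(C)` is nontrivial, there are `C⋆ > 0` and a helicity-free `W ∈ 𝔓(C⋆)` with
`‖W(−1,0)‖ = C⋆`, `√(−t)‖W(t,x)‖ ≤ ‖W(−1,0)‖` on the slab, and `C⋆` minimal among the Type-I constants of nontrivial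
helicity-free elements.  So a K2⁗ residue prover may work at a HOT SPOT with the sub-class-sharp constant. -/
theorem exists_frobenius_extremal
    (hex : ∃ (C : ℝ) (u : ℝ → EuclideanSpace ℝ (Fin 3) → EuclideanSpace ℝ (Fin 3)), IsTypeIAncientMild C u ∧
      (∀ s < 0, ∀ y, ⟪u s y, curl (u s) y⟫_ℝ = 0) ∧ ∃ t < 0, ∃ x, u t x ≠ 0) :
    ∃ (Cs : ℝ) (W : ℝ → EuclideanSpace ℝ (Fin 3) → EuclideanSpace ℝ (Fin 3)), 0 < Cs ∧ IsTypeIAncientMild Cs W ∧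
      (∀ s < 0, ∀ y, ⟪W s y, curl (W s) y⟫_ℝ = 0) ∧
      ‖W (-1) 0‖ = Cs ∧
      (∀ t < 0, ∀ x, Real.sqrt (-t) * ‖W t x‖ ≤ ‖W (-1) 0‖) ∧
      ∀ (C' : ℝ) (u' : ℝ → EuclideanSpace ℝ (Fin 3) → EuclideanSpace ℝ (Fin 3)), IsTypeIAncientMild C' u' →
        (∀ s < 0, ∀ y, ⟪u' s y, curl (u' s) y⟫_ℝ = 0) → (∃ t < 0, ∃ x, u' t x ≠ 0) → Cs ≤ C' :=
  exists_extremal_of_subclass (fun u => ∀ s < 0, ∀ y, ⟪u s y, curl (u s) y⟫_ℝ = 0)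
    (fun _ x₀ h => helicityFree_translate h x₀) (fun _ _ hc h => helicityFree_nsRescale h hc)
    (fun _ _ hV hpt hDpt => helicityFree_of_tendsto hV hpt hDpt) hex

/-- **K2⁗ (profile form) ⇐ «no extremal helicity-free profile»**: if NO `C⋆ > 0` and helicity-free `W ∈ 𝔓(C⋆)` with
`‖W(−1,0)‖ = C⋆ ≥ √(−t)‖W(t,x)‖` exist, then every helicity-free profile of the Type-I class (rate, continuity,
unit-viscosity Oseen–Duhamel identity, divergence-free slices) is not backward-singular at the apex — indeed it
vanishes identically. -/
theorem frobeniusProfileRigidity_of_no_extremal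
    (hno : ¬ ∃ (Cs : ℝ) (W : ℝ → EuclideanSpace ℝ (Fin 3) → EuclideanSpace ℝ (Fin 3)), 0 < Cs ∧
      IsTypeIAncientMild Cs W ∧ (∀ s < 0, ∀ y, ⟪W s y, curl (W s) y⟫_ℝ = 0) ∧ ‖W (-1) 0‖ = Cs ∧
      (∀ t < 0, ∀ x, Real.sqrt (-t) * ‖W t x‖ ≤ ‖W (-1) 0‖)) :
    ∀ (C : ℝ) (v : ℝ → EuclideanSpace ℝ (Fin 3) → EuclideanSpace ℝ (Fin 3)),
      Literature.Analysis.FluidPDE.HasTypeITimeDecay C v →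
      ContinuousOn (Function.uncurry v) (Set.Iio (0 : ℝ) ×ˢ Set.univ) →
      (∀ s t : ℝ, s < t → t < 0 → ∀ x, v t x =
        Literature.Analysis.UnboundedOperators.heatExtension (v s) (t - s) x -
          Literature.Analysis.FluidPDE.oseenDuhamel 1 s v v t x) →
      (∀ t < 0, Literature.Analysis.FluidPDE.VectorCalculus.IsDivFree (v t)) →
      (∀ s < 0, ∀ y : EuclideanSpace ℝ (Fin 3), ⟪v s y, Literature.Analysis.FluidPDE.curl (v s) y⟫_ℝ = 0) →
      ¬ Literature.Analysis.FluidPDE.IsBackwardSingularPoint v 0 := by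
  intro C v hrate hcont hmild hdiv hhel
  refine not_backwardSingular_of_zero fun t ht x => ?_
  by_contra hx
  have hA : IsTypeIAncientMild C v := isTypeIAncientMild_of_class hrate hcont hmild hdiv
  obtain ⟨Cs, W, hCs, hW, hWhel, hnorm, hhot, -⟩ := exists_frobenius_extremal ⟨C, v, hA, hhel, t, ht, x, hx⟩
  exact hno ⟨Cs, W, hCs, hW, hWhel, hnorm, hhot⟩

end Summit.NavierStokesRegularity.NavierStokesRegularity.Theorems.LocalHelicityTubeDoorFrobeniusProfileRigidityExtremal

end
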